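import Mathlib.Analysis.SpecialFunctions.Pow.Real
import Mathlib.Analysis.SpecialFunctions.Trigonometric.Basic

/-!
# drefute gen 2 — arithmetic bookkeeping for line `cgy-variance-pivot` (crux stmt-SmoothPoincare4-10870)

Real-arithmetic certificates for the gen-2 briefing (`Negative-notes/DrefuteG2-cgy-variance-pivot.md`).
Throughout `V = Vol(M,g)`, `D = ∫(R−2)² dV`, `W2 = ∫|W|² dV` ((0,4)-norm), `R2 = ∫R² dV`, `Rm2 = ∫|Rm|² dV`
for a gradient shrinker `Ric + Hess f = g/2` on a closed `M ≃ₕ S⁴`; the LANDED identities give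
`R2 = D + 4V` (`∫R = 2V`) and, with Chern–Gauss–Bonnet at `χ = 2`, `W2 = 64π² − (2/3)V + D/3`.

* `catino_condition_iff` — Catino 2016 (arXiv:1509.07416, Rem. 1.3) pinching
  `W2 + (2/39) R2 ≤ (160/13)π² χ` at `χ = 2` reads `15 D ≤ 18 V − 1536 π²`, i.e. `D ≤ 1.2 V − 102.4 π²`.
* `catino_strip_lt_budget` — that strip lies strictly below the budget line `2V − 96π²`: integral
  pinching neither proves nor threatens STUB 1.
* `riemannEnergy_eq` — `Rm2 = W2 + 2∫|E|² + R2/6 = 64π² + D` (so a budget violator has `Rm2 ≥ 2V − 32π²`).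
* `budget_of_rmin_fmax` — the crude sufficient condition from `D = ∫|∇f|²(3 − R)`:
  `D ≤ (3 − R_min)(f_max − 2) V` and `(3 − R_min)(f_max − 2) V < 2V − 96π²` give the budget.
-/

namespace DrefuteG2

/-- Catino's `χ = 2` pinching condition in the variables `(D, V)`. [cite: Catino2016, Rem. 1.3] -/
theorem catino_condition_iff (V D W2 R2 : ℝ) (hR2 : R2 = D + 4 * V)
    (hW2 : W2 = 64 * Real.pi ^ 2 - 2 / 3 * V + D / 3) :
    W2 + 2 / 39 * R2 ≤ 160 / 13 * Real.pi ^ 2 * 2 ↔ 15 * D ≤ 18 * V - 1536 * Real.pi ^ 2 := by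
  subst hR2 hW2
  constructor <;> intro h <;> nlinarith [h]

/-- The Catino strip `D ≤ 1.2V − 102.4π²` is strictly inside the budget region `D < 2V − 96π²`
(for `V ≥ 0`). [folklore] -/
theorem catino_strip_lt_budget (V D : ℝ) (hV : 0 ≤ V) (h : 15 * D ≤ 18 * V - 1536 * Real.pi ^ 2) :
    D < 2 * V - 96 * Real.pi ^ 2 := by
  have hπ : 0 < Real.pi ^ 2 := by positivity
  nlinarith

/-- `∫|Rm|² = ∫|W|² + 2∫|E|² + (1/6)∫R²` with `∫|E|² = D/4`, `∫R² = D + 4V` and CGB at `χ = 2`: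
`∫|Rm|² = 64π² + D`. [folklore] -/
theorem riemannEnergy_eq (V D W2 R2 E2 Rm2 : ℝ) (hR2 : R2 = D + 4 * V) (hE2 : E2 = D / 4)
    (hW2 : W2 = 64 * Real.pi ^ 2 - 2 / 3 * V + D / 3) (hRm : Rm2 = W2 + 2 * E2 + R2 / 6) :
    Rm2 = 64 * Real.pi ^ 2 + D := by
  subst hR2 hE2 hW2 hRm
  ring

/-- A budget violator (`2V − 96π² ≤ D`) has `∫|Rm|² ≥ 2V − 32π²`. [folklore] -/
theorem riemannEnergy_of_violator (V D Rm2 : ℝ) (hRm : Rm2 = 64 * Real.pi ^ 2 + D)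
    (hviol : 2 * V - 96 * Real.pi ^ 2 ≤ D) : 2 * V - 32 * Real.pi ^ 2 ≤ Rm2 := by
  subst hRm
  linarith

/-- Crude sufficient condition from the identity `D = ∫|∇f|²(3 − R) dV ≤ (3 − R_min)·∫|∇f|²` and
`∫|∇f|² = ∫(f − R) = ∫f − 2V ≤ (f_max − 2)V`: if `(3 − R_min)(f_max − 2)·V < 2V − 96π²` the budget
holds. [folklore] -/
theorem budget_of_rmin_fmax (V D Rmin fmax G : ℝ) (hRmin : Rmin ≤ 3)
    (hD : D ≤ (3 - Rmin) * G) (hGle : G ≤ (fmax - 2) * V)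
    (hsmall : (3 - Rmin) * ((fmax - 2) * V) < 2 * V - 96 * Real.pi ^ 2) :
    D < 2 * V - 96 * Real.pi ^ 2 := by
  have h1 : (3 - Rmin) * G ≤ (3 - Rmin) * ((fmax - 2) * V) :=
    mul_le_mul_of_nonneg_left hGle (by linarith)
  linarith

/-- Numerical instance: `R_min ≥ 1`, `f_max ≤ 2.45`, `V ≥ 93.5π²` suffice
(`2·0.45 = 0.9 < 2 − 96/93.5 = 0.973…`). [folklore] -/
theorem budget_instance (V D G Rmin fmax : ℝ) (hV : 93.5 * Real.pi ^ 2 ≤ V)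
    (hRmin : 1 ≤ Rmin) (hfmax : fmax ≤ 2.45) (hG : 0 ≤ G)
    (hD : D ≤ (3 - Rmin) * G) (hGle : G ≤ (fmax - 2) * V) :
    D < 2 * V - 96 * Real.pi ^ 2 := by
  have hπ : 0 < Real.pi ^ 2 := by positivity
  have hVpos : 0 < V := by nlinarith
  have h1 : (3 - Rmin) * G ≤ 2 * G := by nlinarith
  have h2 : G ≤ 0.45 * V := by nlinarith
  nlinarith

end DrefuteG2
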